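import Summits.QuantumFields.QCD.Theorems.QuarksAsStableActionCriticalLineDiamagnetismStubFrequencyDiamagnetismAux2
import Summits.QuantumFields.QCD.Theorems.QuarksAsStableActionWilsonQuarkStabilityStubStaticSliceBoundAux

/-!
# Stub `stub_frequencyDiamagnetism` of line `Sketch` — auxiliary file 3: the static slice bound for the 2D frequency
determinant along the first coordinate
(crux `Summit.QuantumFields.QCD.Theses.QuarksAsStableAction.CriticalLineDiamagnetism`, item stmt-QuantumFields-9734,
static route for odd tori)

From Lüscher's transfer-matrix form of the 2D frequency determinant (auxiliary file 2,
`det tfreqOp A = (∏_t det E_t) · det(1 − ∏_{t<L} M_t W_t)`, `M_t > 0`, `W_t` seam-signed unitary transporters) exactly as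
the sibling crux 9736 derives its static slice bound (`stub_staticSliceBound`, template): by the chain-block lemma `hE`
(`stub_normDetChainBlock`) `‖det E_t‖ = ‖det (A_tP⁻ − P⁺)‖`; by the cyclic Hölder / chessboard inequality `hH`
(`stub_cyclicHolder`, odd `L`) on Fock space (`StaticSliceBound.det_one_sub_prod_pow_le`)
`‖det(1 − ∏ M_tW_t)‖^L ≤ ∏_s Re det(1 + M_s^L)`; and for the STATIC field `S_s A` (links along the second coordinate
read on row `s`, links along the first coordinate trivial — the seam sign is built into the operator) the same formula
reads `‖det tfreqOp (S_s A)‖ = ‖det (A_sP⁻ − P⁺)‖^L · Re det(1 + M_s^L)` (`norm_det_tfreqOp_static`).  Hence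
`‖det tfreqOp A‖^L ≤ ∏_s ‖det tfreqOp (S_s A)‖` (`tfreqOp_staticSliceBound`), i.e. — by `det_tfreqOp` — the static slice
bound for the literal frequency operator `fD` of the stub (registered auxiliary theorem `stub_frequencyDiamagnetismAux3`,
hypotheses `hH`, `hE` verbatim those of `stub_staticSliceBound`).
References: M. Lüscher, Commun. Math. Phys. 54 (1977) 283; J. Fröhlich, R. Israel, E. H. Lieb, B. Simon, Commun. Math.
Phys. 62 (1978) 1.
-/

noncomputable section

open scoped BigOperators Matrix ComplexConjugate Kronecker ComplexOrder
open Finset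
open Literature.MathematicalPhysics.QuantumLattice Literature.MathematicalPhysics.QuantumFieldTheory
  Literature.Probability.LatticeModels

namespace Summit.QuantumFields.QCD.Cruxes.CriticalLineDiamagnetism.ChessboardCellGain

namespace FrequencyDiamagnetism

open Matrix Complex
open Summit.QuantumFields.QCD.Cruxes.StableActionBridge.Sketch
open Summit.QuantumFields.QCD.Cruxes.WilsonQuarkStability.FreeTangentLandauChessboard

/-! ### The slice data as functions of the field -/

section Congr

variable {L : ℕ} [NeZero L] (A A' : ZMod L → ZMod L → Fin 4 → Matrix.unitaryGroup (Fin 3) ℂ) (m ω₀ ω₁ : ℝ)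
  (t s : ZMod L)

omit [NeZero L] in
/-- The hop of row `t` only sees the links `A(t,·,3)`. -/
theorem hop3_congr (h : ∀ x, A' t x 3 = A s x 3) : hop3 A' t = hop3 A s := by
  simp only [hop3, h]

omit [NeZero L] in
/-- The spin-blind slice operator of row `t` only sees the links `A(t,·,3)`. -/
theorem massHop_congr (h : ∀ x, A' t x 3 = A s x 3) : massHop A' m ω₀ ω₁ t = massHop A m ω₀ ω₁ s := by
  rw [massHop, massHop, hop3_congr A A' t s h]

omit [NeZero L] in
/-- The coefficients `C_{t,j}` only see the links `A(t,·,3)`. -/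
theorem hopCoeff_congr (h : ∀ x, A' t x 3 = A s x 3) : hopCoeff A' ω₀ ω₁ t = hopCoeff A ω₀ ω₁ s := by
  rw [hopCoeff, hopCoeff, hop3_congr A A' t s h]

/-- The slice operator of row `t` only sees the links `A(t,·,3)`. -/
theorem sliceOp_congr (h : ∀ x, A' t x 3 = A s x 3) : sliceOp A' m ω₀ ω₁ t = sliceOp A m ω₀ ω₁ s := by
  rw [sliceOp, sliceOp, massHop_congr A A' m ω₀ ω₁ t s h, hopCoeff_congr A A' ω₀ ω₁ t s h]

/-- `B̂_t` only sees the links `A(t,·,3)`. -/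
theorem sliceBh_congr (h : ∀ x, A' t x 3 = A s x 3) : sliceBh A' m ω₀ ω₁ t = sliceBh A m ω₀ ω₁ s := by
  rw [sliceBh, sliceBh, massHop_congr A A' m ω₀ ω₁ t s h]

/-- The one-step matrix of row `t` only sees the links `A(t,·,3)`. -/
theorem oneStep_congr (h : ∀ x, A' t x 3 = A s x 3) : oneStep A' m ω₀ ω₁ t = oneStep A m ω₀ ω₁ s := by
  rw [oneStep, oneStep, sliceOp_congr A A' m ω₀ ω₁ t s h, sliceBh_congr A A' m ω₀ ω₁ t s h]

omit [NeZero L] in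
/-- With trivial links `A(t,·,2) = 1` the temporal transporters of row `t` are the signs `1` (off the seam) and `−1`
(on the seam `t = −1`). -/
theorem link2_of_apply_eq_one (h : ∀ x, A' t x 2 = 1) :
    ((t ≠ -1 → link2 A' t = 1) ∧ (t = -1 → link2 A' t = -1)) ∧ (link2' A' t = 1 ∨ link2' A' t = -1) := by
  by_cases ht : t = -1
  · refine ⟨⟨fun h' => absurd ht h', fun _ => ?_⟩, Or.inr ?_⟩
    · simp only [link2, h, OneMemClass.coe_one]
      simp only [ht, if_true, neg_smul, one_smul]
      exact StaticSliceBound.colourLift_neg_one (ZMod L) 3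
    · simp only [link2', h, OneMemClass.coe_one, star_one]
      simp only [ht, if_true, neg_smul, one_smul]
      exact StaticSliceBound.colourLift_neg_one (ZMod L) 3
  · refine ⟨⟨fun _ => ?_, fun h' => absurd h' ht⟩, Or.inl ?_⟩
    · simp only [link2, h, ht, if_false, OneMemClass.coe_one, one_smul]
      exact StaticSliceBound.colourLift_one (ZMod L) 3
    · simp only [link2', h, ht, if_false, OneMemClass.coe_one, star_one, one_smul]
      exact StaticSliceBound.colourLift_one (ZMod L) 3

omit [NeZero L] in
/-- The backward temporal transporter is the adjoint of the forward one. -/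
theorem star_link2' : star (link2' A t) = link2 A t := by
  rw [Matrix.star_eq_conjTranspose]
  ext ⟨x, c, α⟩ ⟨y, e, β⟩
  simp only [link2, link2', Matrix.conjTranspose_apply, Matrix.of_apply]
  by_cases hxy : x = y ∧ α = β
  · obtain ⟨rfl, rfl⟩ := hxy
    simp only [and_self, if_true, Matrix.smul_apply, smul_eq_mul, star_mul', star_seamSign, Matrix.star_apply,
      star_star]
  · rw [if_neg hxy, if_neg (fun h' => hxy ⟨h'.1.symm, h'.2.symm⟩), star_zero]

omit [NeZero L] in
/-- The frequency operator only reads the links along the two coordinates (`μ = 2, 3`). -/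
theorem freqOp_congr_links (g : Fin 4 → Matrix (Fin 4) (Fin 4) ℂ) (h2 : ∀ t x, A' t x 2 = A t x 2)
    (h3 : ∀ t x, A' t x 3 = A t x 3) : freqOp g A' m ω₀ ω₁ = freqOp g A m ω₀ ω₁ := by
  simp only [freqOp, h2, h3]

end Congr

/-! ### The frequency determinant of a static field -/

/-- **The frequency determinant of a static field.**  For the static field `S_s A` (links `A(s,·,3)` on every row,
trivial links along the first coordinate), `‖det tfreqOp (S_s A)‖ = ‖det (A_sP⁻ − P⁺)‖^L · Re det(1 + M_s^L)` in terms of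
the transfer data of `A`, given the chain-block lemma `hE`. -/
theorem norm_det_tfreqOp_static {L : ℕ} [NeZero L]
    (hE : ∀ {k : Type} [Fintype k] [DecidableEq k] (A Pp Pm W : Matrix k k ℂ),
      Pp + Pm = 1 → Pp * Pm = 0 → Pm * Pp = 0 → Ppᴴ = Pp → Pmᴴ = Pm →
      W ∈ Matrix.unitaryGroup k ℂ → W * Pp = Pp * W → W * Pm = Pm * W →
      ‖(A * Pm - Pp * W).det‖ = ‖(A * Pm - Pp).det‖)
    (A : ZMod L → ZMod L → Fin 4 → Matrix.unitaryGroup (Fin 3) ℂ) {m : ℝ} (hm : -1 < m) (ω₀ ω₁ : ℝ) (s : ZMod L) :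
    ‖(tfreqOp (fun _ x μ => if μ = 3 then A s x 3 else 1) m ω₀ ω₁).det‖ =
      ‖(sliceOp A m ω₀ ω₁ s * projM L - projP L).det‖ ^ L * ((1 + oneStep A m ω₀ ω₁ s ^ L).det).re := by
  -- adapted from `StaticSliceBound.norm_det_wilsonDirac_static` (…WilsonQuarkStabilityStubStaticSliceBound.lean)
  have h3 : ∀ (t x : ZMod L), (fun (_ : ZMod L) (x : ZMod L) (μ : Fin 4) =>
      if μ = 3 then A s x 3 else (1 : Matrix.unitaryGroup (Fin 3) ℂ)) t x 3 = A s x 3 := fun t x => if_pos rfl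
  have h2 : ∀ (t x : ZMod L), (fun (_ : ZMod L) (x : ZMod L) (μ : Fin 4) =>
      if μ = 3 then A s x 3 else (1 : Matrix.unitaryGroup (Fin 3) ℂ)) t x 2 = 1 := fun t x => if_neg (by decide)
  obtain ⟨hdet, hMpos⟩ := tfreqOp_det_transfer_form (fun _ x μ => if μ = 3 then A s x 3 else 1) hm ω₀ ω₁
  have hA : ∀ t, sliceOp (fun _ x μ => if μ = 3 then A s x 3 else 1) m ω₀ ω₁ t = sliceOp A m ω₀ ω₁ s := fun t =>
    sliceOp_congr A _ m ω₀ ω₁ t s (h3 t)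
  have hM : ∀ t, oneStep (fun _ x μ => if μ = 3 then A s x 3 else 1) m ω₀ ω₁ t = oneStep A m ω₀ ω₁ s := fun t =>
    oneStep_congr A _ m ω₀ ω₁ t s (h3 t)
  have hW := fun t : ZMod L => link2_of_apply_eq_one (fun _ x μ => if μ = 3 then A s x 3 else 1) t (h2 t)
  have hP : projP L + projM L = 1 := liftProjPlus_add_liftProjMinus (ZMod L) 3
  have hPQ : projP L * projM L = 0 := liftProjPlus_mul_liftProjMinus (ZMod L) 3
  have hQP : projM L * projP L = 0 := liftProjMinus_mul_liftProjPlus (ZMod L) 3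
  have hPph : (projP L)ᴴ = projP L := (slice_claims A hm ω₀ ω₁ s).2.2.1
  have hPmh : (projM L)ᴴ = projM L := (slice_claims A hm ω₀ ω₁ s).2.2.2.1
  have hblock : ∀ t, ‖(sliceOp (fun _ x μ => if μ = 3 then A s x 3 else 1) m ω₀ ω₁ t * projM L -
      projP L * link2' (fun _ x μ => if μ = 3 then A s x 3 else 1) (t - 1)).det‖ =
      ‖(sliceOp A m ω₀ ω₁ s * projM L - projP L).det‖ := fun t => by
    obtain ⟨hu, hcp⟩ := StaticSliceBound.sign_unitary_comm _ (projP L) (hW (t - 1)).2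
    obtain ⟨-, hcm⟩ := StaticSliceBound.sign_unitary_comm _ (projM L) (hW (t - 1)).2
    rw [hA t]
    exact hE _ _ _ _ hP hPQ hQP hPph hPmh hu hcp hcm
  have hprod : ((List.range L).map fun i : ℕ => oneStep (fun _ x μ => if μ = 3 then A s x 3 else 1) m ω₀ ω₁ (i : ZMod L) *
      link2 (fun _ x μ => if μ = 3 then A s x 3 else 1) (i : ZMod L)).prod = -(oneStep A m ω₀ ω₁ s ^ L) := by
    have : (fun i : ℕ => oneStep (fun _ x μ => if μ = 3 then A s x 3 else 1) m ω₀ ω₁ (i : ZMod L) *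
        link2 (fun _ x μ => if μ = 3 then A s x 3 else 1) (i : ZMod L)) =
        fun i : ℕ => oneStep A m ω₀ ω₁ s * link2 (fun _ x μ => if μ = 3 then A s x 3 else 1) (i : ZMod L) :=
      funext fun i => by rw [hM]
    rw [this]
    exact StaticSliceBound.prod_map_range_sign (oneStep A m ω₀ ω₁ s) _ (fun t => (hW t).1.1) (fun t => (hW t).1.2)
  have hMs : (oneStep A m ω₀ ω₁ s).PosDef := hM 0 ▸ hMpos 0
  rw [hdet, norm_mul, norm_prod, Finset.prod_congr rfl fun t _ => hblock t, Finset.prod_const, Finset.card_univ,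
    ZMod.card, hprod, sub_neg_eq_add, StaticSliceBound.norm_det_one_add_pow hMs]

/-! ### The static slice bound along the first coordinate -/

/-- **The static slice bound for the 2D frequency determinant along the first coordinate**:
`‖det tfreqOp A‖^L ≤ ∏_s ‖det tfreqOp (S_s A)‖` for `m > −1`, given the cyclic Hölder inequality `hH` and the
chain-block lemma `hE` (the assembly of `stub_staticSliceBound` run on the time form). -/
theorem tfreqOp_staticSliceBound {L : ℕ} [NeZero L]
    (hH : ∀ {k : Type} [Fintype k] [DecidableEq k] (T u : ZMod L → Matrix k k ℂ),
      (∀ i, (T i).PosDef) → (∀ i, u i ∈ Matrix.unitaryGroup k ℂ) →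
      ‖((List.range L).map fun i : ℕ => T (i : ZMod L) * u (i : ZMod L)).prod.trace‖ ^ L ≤
        ∏ i : ZMod L, ((T i) ^ L).trace.re)
    (hE : ∀ {k : Type} [Fintype k] [DecidableEq k] (A Pp Pm W : Matrix k k ℂ),
      Pp + Pm = 1 → Pp * Pm = 0 → Pm * Pp = 0 → Ppᴴ = Pp → Pmᴴ = Pm →
      W ∈ Matrix.unitaryGroup k ℂ → W * Pp = Pp * W → W * Pm = Pm * W →
      ‖(A * Pm - Pp * W).det‖ = ‖(A * Pm - Pp).det‖)
    (A : ZMod L → ZMod L → Fin 4 → Matrix.unitaryGroup (Fin 3) ℂ) {m : ℝ} (hm : -1 < m) (ω₀ ω₁ : ℝ) :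
    ‖(tfreqOp A m ω₀ ω₁).det‖ ^ L ≤
      ∏ s : ZMod L, ‖(tfreqOp (fun _ x μ => if μ = 3 then A s x 3 else 1) m ω₀ ω₁).det‖ := by
  -- adapted from `stub_staticSliceBound` (…WilsonQuarkStabilityStubStaticSliceBound.lean)
  obtain ⟨hdet, hMpos⟩ := tfreqOp_det_transfer_form A hm ω₀ ω₁
  have hP : projP L + projM L = 1 := liftProjPlus_add_liftProjMinus (ZMod L) 3
  have hPQ : projP L * projM L = 0 := liftProjPlus_mul_liftProjMinus (ZMod L) 3
  have hQP : projM L * projP L = 0 := liftProjMinus_mul_liftProjPlus (ZMod L) 3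
  have hPph : (projP L)ᴴ = projP L := (slice_claims A hm ω₀ ω₁ 0).2.2.1
  have hPmh : (projM L)ᴴ = projM L := (slice_claims A hm ω₀ ω₁ 0).2.2.2.1
  have hsp := fun t : ZMod L => slice_spin_structure A m ω₀ ω₁ t
  have hW'p : ∀ t, link2' A t * projP L = projP L * link2' A t := fun t => (hsp t).2.2.2.2.2.2.1
  have hW'm : ∀ t, link2' A t * projM L = projM L * link2' A t := fun t => (hsp t).2.2.2.2.2.2.2.1
  have hW'W : ∀ t, link2' A t * link2 A t = 1 := fun t => (hsp t).2.2.2.2.2.2.2.2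
  have hW'u : ∀ t, link2' A t ∈ Matrix.unitaryGroup _ ℂ := fun t =>
    Matrix.mem_unitaryGroup_iff.mpr (by rw [star_link2', hW'W])
  have hWu : ∀ t, link2 A t ∈ Matrix.unitaryGroup _ ℂ := fun t => by
    rw [← star_link2']
    exact Unitary.star_mem (hW'u t)
  have hEV : ∀ t, ‖(sliceOp A m ω₀ ω₁ t * projM L - projP L * link2' A (t - 1)).det‖ =
      ‖(sliceOp A m ω₀ ω₁ t * projM L - projP L).det‖ := fun t =>
    hE _ _ _ _ hP hPQ hQP hPph hPmh (hW'u _) (hW'p _) (hW'm _)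
  have hH' := StaticSliceBound.det_one_sub_prod_pow_le hH (oneStep A m ω₀ ω₁) (link2 A) hMpos hWu
  have hstat := fun s : ZMod L => norm_det_tfreqOp_static hE A hm ω₀ ω₁ s
  rw [hdet, norm_mul, norm_prod, mul_pow, Finset.prod_congr rfl fun t _ => hEV t,
    Finset.prod_congr rfl fun s _ => hstat s, Finset.prod_mul_distrib, Finset.prod_pow]
  exact mul_le_mul_of_nonneg_left hH' (pow_nonneg (Finset.prod_nonneg fun _ _ => norm_nonneg _) _)

end FrequencyDiamagnetism

/-! ### Registered auxiliary theorem -/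

/-- **Aux stub `stub_frequencyDiamagnetismAux3`** (the static slice bound for the 2D frequency determinant along the
first coordinate): for every 2D `U(3)` field `A`, `m > −1` and real frequency pair,
`‖det fD A‖^L ≤ ∏_s ‖det fD (S_s A)‖` where the static field `S_s A` reads the links along the second coordinate on
row `s` and has trivial links along the first one — GIVEN the cyclic Hölder / chessboard inequality `hH`
(`stub_cyclicHolder`, odd `L`) and the chain-block lemma `hE` (`stub_normDetChainBlock`), verbatim the hypotheses of
the sibling crux's `stub_staticSliceBound` (`fD` literally the frequency operator of the stub `stub_frequencyDiamagnetism`). -/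
theorem stub_frequencyDiamagnetismAux3 : ∀ (L : ℕ) [NeZero L], (∀ {k : Type} [Fintype k] [DecidableEq k] (T u : ZMod L → Matrix k k ℂ), (∀ i, (T i).PosDef) → (∀ i, u i ∈ Matrix.unitaryGroup k ℂ) → ‖((List.range L).map fun i : ℕ => T (i : ZMod L) * u (i : ZMod L)).prod.trace‖ ^ L ≤ ∏ i : ZMod L, ((T i) ^ L).trace.re) → (∀ {k : Type} [Fintype k] [DecidableEq k] (A Pp Pm W : Matrix k k ℂ), Pp + Pm = 1 → Pp * Pm = 0 → Pm * Pp = 0 → Ppᴴ = Pp → Pmᴴ = Pm → W ∈ Matrix.unitaryGroup k ℂ → W * Pp = Pp * W → W * Pm = Pm * W → ‖(A * Pm - Pp * W).det‖ = ‖(A * Pm - Pp).det‖) → ∀ (A : ZMod L → ZMod L → Fin 4 → Matrix.unitaryGroup (Fin 3) ℂ) (m : ℝ), -1 < m → ∀ ω₀ ω₁ : ℝ, let fD := fun (A : ZMod L → ZMod L → Fin 4 → Matrix.unitaryGroup (Fin 3) ℂ) (m ω₀ ω₁ : ℝ) => Matrix.of fun (p q : (ZMod L × ZMod L) × Fin 3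 × Fin 4) => (if p.1 = q.1 ∧ p.2.1 = q.2.1 then (((m + 4 - Real.cos ω₀ - Real.cos ω₁ : ℝ) : ℂ) * (1 : Matrix (Fin 4) (Fin 4) ℂ) p.2.2 q.2.2 + Complex.I * (((Real.sin ω₀ : ℝ) : ℂ) * euclideanGamma 0 p.2.2 q.2.2 + ((Real.sin ω₁ : ℝ) : ℂ) * euclideanGamma 1 p.2.2 q.2.2)) else 0) - (1 / 2 : ℂ) * ((if q.1 = (p.1.1 + 1, p.1.2) then ((1 : Matrix (Fin 4) (Fin 4) ℂ) - euclideanGamma 2) p.2.2 q.2.2 * ((if p.1.1 = -1 then (-1 : ℂ) else 1) * (A p.1.1 p.1.2 2 : Matrix (Fin 3) (Fin 3) ℂ) p.2.1 q.2.1) else 0) + (if p.1 = (q.1.1 + 1, q.1.2) then ((1 : Matrix (Fin 4) (Fin 4) ℂ) + euclideanGamma 2) p.2.2 q.2.2 * ((if q.1.1 = -1 then (-1 : ℂ) else 1) * (star (A q.1.1 q.1.2 2 : Matrix (Fin 3) (Fin 3) ℂ)) p.2.1 q.2.1) else 0) + (if q.1 = (p.1.1, p.1.2 + 1) then ((1 :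 Matrix (Fin 4) (Fin 4) ℂ) - euclideanGamma 3) p.2.2 q.2.2 * ((if p.1.2 = -1 then (-1 : ℂ) else 1) * (A p.1.1 p.1.2 3 : Matrix (Fin 3) (Fin 3) ℂ) p.2.1 q.2.1) else 0) + (if p.1 = (q.1.1, q.1.2 + 1) then ((1 : Matrix (Fin 4) (Fin 4) ℂ) + euclideanGamma 3) p.2.2 q.2.2 * ((if q.1.2 = -1 then (-1 : ℂ) else 1) * (star (A q.1.1 q.1.2 3 : Matrix (Fin 3) (Fin 3) ℂ)) p.2.1 q.2.1) else 0)); ‖(fD A m ω₀ ω₁).det‖ ^ L ≤ ∏ s : ZMod L, ‖(fD (fun _ x μ => if μ = 3 then A s x 3 else 1) m ω₀ ω₁).det‖ := by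
  intro L _ hH hE A m hm ω₀ ω₁ fD
  have h := FrequencyDiamagnetism.tfreqOp_staticSliceBound hH hE A hm ω₀ ω₁
  simp only [FrequencyDiamagnetism.det_tfreqOp] at h
  exact h

end Summit.QuantumFields.QCD.Cruxes.CriticalLineDiamagnetism.ChessboardCellGain

end
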